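import Literature.MathematicalPhysics.QuantumFieldTheory.Balaban1983to89.B1Eq324FluctuationSubgaussian
import Literature.MathematicalPhysics.QuantumFieldTheory.Balaban1983to89.B1Eq356FluctuationIntegral
import Literature.MathematicalPhysics.QuantumFieldTheory.Balaban1983to89.B1Prop32InteractionBound

/-!
# `Balaban1983to89.B1Eq357FluctuationPolynomial` — T. Bałaban, *(Higgs)₂,₃ quantum fields in a finite volume. I. A lower bound*,
Commun. Math. Phys. **85** (1982) 603–626 [Balaban1982Higgs1], **(3.57) p. 622 / p. 623: THE INTERACTION `V^{(k)}` OF PROPOSITION 3.2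
AS A RANDOM VARIABLE ON THE PRODUCT LAW `dμ_{C^{(k)}}(A′) dμ_{C^{(k)}(B^{(k+1)})}(φ′)` OF (3.56)** — the polynomial (3.57) (p14's
`B1Ineq358TreeDecaySum.poly357` in the unit-lattice components `B1Prop32InteractionBound.legVal`) composed with the carrier of r14's
`B1Eq356FluctuationIntegral.integral356C` (the typer's Gaussian probability measures `HiggsFluctMeasure.fluctMeasure` ⊗ `HiggsCondGauss228.condGauss`);
its SLOT NORMAL FORM `Σ_i a_i Π_{s ∈ J_i} X_{i s}` (the shape of r14's `B1Eq324GaussianMomentLeaf.poly I J a X`); EVERY LEG VARIABLE `X_{i s}`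
SUB-GAUSSIAN UNDER THE PRODUCT LAW WITH ONE PARAMETER; the coefficient sum `Σ_i |a_i|` under (3.58); *"the restrictions on the fields"*
`|V^{(k)}| ≤ B` on the support of `χ(A′)χ(φ′)`; and the product cut-off `χ(A′)χ(φ′)` on the product space (measurable, `[0,1]`, mean = product
of the two small-field probabilities, tail `≤ τ_A + τ_φ`, `⟨χ⟩ ≥ ½` once both tails are `≤ ¼`) — definitions WITH BODY + theorems, no `Prop`-valued fact

statement-level skeleton of published theorems with citation tags; proofs where landed; nothing here is a claim about the Yang–Mills mass gap

PDF held: `paper:balaban1982-cmp85-higgs23-i` (journal page = PDF page + 602); pp. 622–623 [PDF 20–21] re-read this session in the materialised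
text `~/.lit/texts/paper-balaban1982-cmp85-higgs23-i/p0020.txt`, `p0021.txt` (render of record for (3.56)–(3.58):
`run/shared/lean/pub/pub-balaban/b2b-balaban-ref1/pages/1982-cmp85-higgs23-I/1982-cmp85-higgs23-I-p020-x2.png`).

CITATION HEADER (lean-in-tree rule).  lit-balaban typed skeleton (HOME `run/shared/lean/pub/lit-balaban/`), unit `lit-balaban-typer` gen 33
(`literature-prover-lit-balaban-typer-g33-0`; TAKING #1 line HOME/STATUS.md 2026-08-24T20:50:40Z, free-target protocol G.5-34 (d)).  SKELETON rows
**B1.Eq3.56** (the fluctuation integral; owner r12, carrier member r14's `B1Eq356FluctuationIntegral`), **B1.Prop3.2** ((3.57)–(3.58); decl of record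
r01/r14 `B1LowerBound.Prop32Printed`, untouched), **B1.Eq3.24** / **B1.Eq3.59** (the cumulant expansion; owner r12, *"DISCHARGED MODULO NAMED
LEAVES"* by p27's `B1Eq324CumulantTaylor.eq324_chi` / `cumulant359_of_leaves`) — CELLS ONLY, no head change.  r14's chain for LEAF (b) of
(3.24)/(3.59) (`lit-balaban-r14/DESIGN-B1-324-leafb-chain.md`): `B1Eq324WeightedCumulantLeaf` (leaf (b) ⇐ tail `⟨1−χ⟩` + `L²(μ)`-moment bounds)
← `B1Eq324GaussianMomentLeaf` (moment bounds ⇐ `V` a polynomial `poly I J a X` in variables with Mathlib's `HasSubgaussianMGF`) ←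
`B1Eq324FluctuationSubgaussian` (the tree's fluctuation variables HAVE `HasSubgaussianMGF`, also under a product with a probability measure);
r14 ibid.: *"What is left for (b) to be hypothesis-free on the carrier — IDENTIFY print's V^{(k)} … as a `poly I J a X` over the PRODUCT
measure dμ_{C^{(k)}}(A′)dμ_{C^{(k)}(B^{(k+1)})}(φ′) … Nobody has typed V^{(k)} as a random variable yet"*.  THIS FILE does that typing on the
carriers of record, BY NAME, NOTHING RESTATED: p14's `B1Ineq358TreeDecaySum.{poly357, polyConst, treeConst, sum_abs_term_le, abs_poly357_le}`
((3.57) re-indexed by total degree; the p. 625 tree-decay summation) and `B1Prop32InteractionBound.{Leg, legVal}` (the unit-lattice components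
`(L^kε)^{(d−2)/2}φ′_j(x)`, `(L^kε)^{(d−2)/2}A′_μ(y)` of (1.22)); the typer's `HiggsFluctMeasure.fluctMeasure` / `HiggsFluctMeasurePos.fluctMeasure_isProbability`
(`dμ_{C^{(k)}}`), `HiggsCondGauss228.{condGauss, fieldOfCrd, isProbabilityMeasure_condGauss}` (`dμ_{C^{(k)}(B^{(k+1)})}` in the coordinates of
II (2.28)); r14's `B1Eq343FluctuationChi.{chiFluctA, chiFluctφ}` ((3.43)/(3.50)), `B1Eq356FluctuationIntegral.integral356C` ((3.56) with body),
`B1Eq324SmallFieldLeaf.{bondVar, siteVar, measurable_fieldOfCrd_apply, measurable_norm_fieldOfCrd}`, `B1Eq324FluctuationSubgaussian.{hasSubgaussianMGF_apply_fluctMeasure,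
hasSubgaussianMGF_fieldOfCrd_apply, hasSubgaussianMGF_fst_prod, hasSubgaussianMGF_snd_prod, one_sub_integral_prod_mul_le}`; Mathlib's
`ProbabilityTheory.HasSubgaussianMGF.const_mul`, `MeasureTheory.integral_prod`, `integral_prod_mul`, `Fintype.sum_sigma`, `Finset.prod_range`.

THE SOURCE TEXT (verbatim).  p. 622 [PDF 20]: *"The next step is a calculation of the integral ∫dμ_{C^{(k)}}(A′) ∫dμ_{C^{(k)}(B^{(k+1)})}(φ′)
χ(A′)χ(φ′) exp(V^{(k)}). (3.56)  Again we will use the lemma from [2]. The following theorem clarifies that the assumptions of the lemma are satisfied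
in our case.  Proposition 3.2. The function V^{(k)}(B^{(k+1)}, ψ, A′^{(k)}, φ′) has the form V^{(k)}(B^{(k+1)}, ψ, A′^{(k)}, φ′) = Σ_{n,m=0}^{n(n̄)}
Σ_{x₁,…,x_n,y₁,…,y_m∈T₁^{(k)}} Σ_{j₁,…,j_n=1}^{N} Σ_{μ₁,…,μ_m=1}^{d} v^{(k)}_{j₁,…,j_n;μ₁,…,μ_m}(B^{(k+1)}, ψ; x₁, …, x_n, y₁, …, y_m) φ′_{j₁}(x₁)…φ′_{j_n}(x_n)
A′_{μ₁}(y₁)…A′_{μ_m}(y_m), (3.57) and the coefficients in the above representation satisfy the inequalities |v^{(k)}_{…}(…)| ≦ O(1)(L^kε)^{κ₀}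
exp(−δ₀d(x₁, …, x_n, y₁, …, y_m)) (3.58) for some independent of k positive constants κ₀, δ₀, and O(1), where d(x₁, …, y_m) denotes a length of the
shortest graph connecting the points x₁, …, y_m."*  p. 623 [PDF 21]: *"In this theorem the representation (3.57) is obvious and the essential content
of it is in the inequalities (3.58). … The properties (3.57) and (3.58) and the properties formulated in the Propositions 2.2 and 2.3 and concerning
the operators defining the basic quadratic forms of the action are sufficient for the assumptions made in the lemma [2]."*  p. 617 [PDF 15] (r14's
reading of record for the measures): *"The fields A′_j … are independent Gaussian random variables with the covariances C^{(j),L^jε}."*  p. 616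
[PDF 14]: *"The coefficients of the polynomial V are proportional to some positive powers of ε."*

HOW IT IS TYPED.  Level `k` of the `ε`-lattice family `P`; the PRODUCT SPACE `Ω356 = (A′ : VecField P k) × (x : coordinates of φ′ on T^{(k)})`
(`HiggsLattice.VecField P k × Crd P N k`, `Crd` = `In (inSet N T^{(k)}) → ℝ` of II (2.28), the scalar field being `fieldOfCrd T^{(k)} x`) with the
PRODUCT LAW `law356 = fluctMeasure P μ₀² a k ⊗ condGauss C Ω B m² a k T^{(k)}` (`Measure.prod`) — the law against which r14's iterated integral
`integral356C` is ONE Bochner integral (§1, Fubini).  `V^{(k)}` is p14's (3.57) `poly357 qmax coef leg` at the legs `leg = legVal k A′ φ′` (the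
unit-lattice components of (1.22); `Leg N d = {1..N} ⊔ {1..d}`; `coef q z κ` = the kernel `v^{(k)}_{j;μ}(B^{(k+1)},ψ; x, y)` of the monomial with
`q = n + m` legs at the points `z` with labels `κ`, the arguments `B^{(k+1)}, ψ` held fixed): `V357 k qmax coef : VecField → ScalarField → ℝ`
(exactly the argument `integral356C` takes) and the random variable `rv357 k qmax coef : Ω356 → ℝ`.  The SLOT NORMAL FORM indexes the monomials
by `Idx = Σ_{q ≤ qmax} (Fin q → T^{(k)}) × (Fin q → Leg)` (a `Fintype`), with coefficients `coefOf`, leg slots `slots i = {0,…,q−1} ⊂ ℕ` and leg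
variables `legRV i s ω` (the `s`-th leg of the monomial `i` evaluated at `ω`; junk `0` for `s ≥ q`): `rv357 ω = Σ_i coefOf i · Π_{s∈slots i} legRV i s ω`
— LITERALLY the body of r14's `B1Eq324GaussianMomentLeaf.poly Finset.univ slots coefOf legRV ω` (p384313, in review at the time of writing; the
`rfl` bridge and leaf (b) for the displayed `V^{(k)}` follow in a separate small file once it has landed, so that no pending module is imported here).

WHAT IS PROVED (kernel-checked, 0 `sorry`, standard axioms; definitions WITH BODY + theorems; NO `Prop`-valued fact).
 §0 `hasSubgaussianMGF_mono` (parameter monotonicity), `hasSubgaussianMGF_const_mul_le` (scaling with a dominated parameter) — generic, Mathlib-level.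
 §1 `law356`, `isProbabilityMeasure_law356`; **`integral356C_eq_integral_law356`**: for `V` measurable on the product and bounded by `B` on
    `{χ(A′)χ(φ′) ≠ 0}`, (3.56) `= ∫ χ(A′)χ(φ′)e^{V} d law356` (the integrand is bounded by `e^{B}`, hence integrable; `MeasureTheory.integral_prod`).
 §2 `V357`, `rv357`, `Idx`, `coefOf`, `slots`, `legRV`; `card_slots_le` (`|slots i| ≤ qmax`); **`rv357_eq_sum_prod`** (the slot normal form).
 §3 `legVal_inl` / `legVal_inr` (unfoldings); **`hasSubgaussianMGF_legVal_law356`**: for every label `l` and site `y` the leg variable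
    `ω ↦ legVal k ω.1 (fieldOfCrd T^{(k)} ω.2) l y` has `HasSubgaussianMGF` under `law356` with the ONE parameter
    `legParam = (L^kε)^{d−2}·σ²⁺`, `σ²` any common bound of the variances `bondVar b`, `siteVar y i` (r14 §2–§4 + `const_mul` + `mono`);
    **`hasSubgaussianMGF_legRV`**: hence every `legRV i s`, `s ∈ slots i` — hypothesis `h` of r14's `integral_abs_poly_pow_le` /
    `abs_sum_cumulantOf_sub_truncExp_le_poly` for the displayed `V^{(k)}`.
 §3′ **`legParam_ineq233`** (at the (2.33)-lower-half bound `σ² = γ₀⁻¹(L^kε)^{−(d−2)}` the rescaling cancels: `legParam = γ₀⁻¹`, independent of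
    `k`, `ε`); **`hasSubgaussianMGF_legVal_of_ineq233`** / **`hasSubgaussianMGF_legRV_of_ineq233`**: WITH PROP. 2.3 (2.33) AS THE INPUT (its lower
    halves for `precOp` and `precOpA`, via r14's `bondVar_le_of_ineq233_lower'` / `siteVar_le_of_ineq233_lower'`) every unit-lattice leg / slot variable
    is sub-Gaussian with parameter `γ₀⁻¹` under `law356` — p. 623 *"the properties formulated in the Propositions 2.2 and 2.3 … are sufficient"*.
 §4 **`sum_abs_coefOf_le`**: under (3.58) in p14's diameter form `|coef q z κ| ≤ A₀e^{−δ₀·diam z}` (`A₀ = O(1)(L^kε)^{κ₀}`),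
    `Σ_i |coefOf i| ≤ A₀·|T^{(k)}|·polyConst qmax (N+d) 1 d δ₀` (p14's `sum_abs_term_le` at `leg ≡ 1`) — the `Σ|a_i|` of r14's `polyMomentBound`.
 §5 `chi_ne_zero_iff`; **`abs_legVal_le_of_chi_ne_zero`** (on `{χ(A′)χ(φ′) ≠ 0}`: `|legVal l y| ≤ (L^kε)^{(d−2)/2}·t`); **`abs_rv357_le_of_chi356_ne_zero`**:
    `|V^{(k)}| ≤ bound357 = A₀·|T^{(k)}|·polyConst qmax (N+d) ((L^kε)^{(d−2)/2}t) d δ₀` there (p14's `abs_poly357_le`) — p27's `hVB` for the displayed `V`.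
 §6 `chi356` (the product cut-off on `Ω356`), `measurable_chi356`, `chi356_mem_Icc`, **`integral_chi356`** (`= ⟨χ(A′)⟩·⟨χ(φ′)⟩`
    `= integral356C … (V = 0)`), **`one_sub_integral_chi356_le`** (tail `≤ τ_A + τ_φ`), `half_le_integral_chi356` (`⟨χ⟩ ≥ ½` once `τ_A, τ_φ ≤ ¼`).
 §7 `measurable_rv357`; **`integral356C_V357_eq`**: (3.56) for the displayed `V^{(k)}` `= ∫ chi356 · e^{rv357} d law356` (t ≥ 0, (3.58)).
HONEST SCOPE.  (a) (3.57)/(3.58) are DISPLAYED hypotheses (the kernels `coef` and their bound `h358` are data: Proposition 3.2 is proved in paper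
III, row B3.Prop1, `typed`); `V^{(k)}`'s arguments `B^{(k+1)}, ψ` are held fixed inside `coef`.  (b) (3.58) is consumed in p14's diameter
currency `e^{−δ₀·diam z}` (weaker than the printed tree length `d ≥ diam`; `B1Ineq358TreeLength`).  (c) The sub-Gaussian parameter is ONE common
bound `σ²` of the covariance diagonals times the unit-lattice rescaling `(L^kε)^{d−2}` (§3), or `γ₀⁻¹` with the (2.33) lower halves DISPLAYED as
hypotheses `h233A` / `h233φ` (§3′; Prop. 2.3 itself is row B1.Prop2.3); independence / joint Gaussianity is not used.  (d) No cumulant statement is made here (that is r14's `B1Eq324GaussianMomentLeaf` + the bridge file); rows keep their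
heads; NOT summit progress; NOT Clay.
-/

open scoped BigOperators NNReal
open _root_.MeasureTheory _root_.ProbabilityTheory

namespace Literature.MathematicalPhysics.QuantumFieldTheory.Balaban1983to89.B1Eq357FluctuationPolynomial

open HiggsLattice (ChargeData)
open HiggsFluctMeasure (fluctMeasure)
open HiggsFluctMeasurePos (fluctMeasure_isProbability)
open B3MultiscaleFields (toSite)
open HiggsCondGauss228 (condGauss fieldOfCrd inSet isProbabilityMeasure_condGauss)
open B2Eq228Conditioning (In)
open B1Eq343FluctuationChi (chiFluct chiFluct_eq_ite chiFluctA chiFluctφ chiFluctA_nonneg chiFluctφ_nonneg chiFluctA_le_one chiFluctφ_le_one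
  measurable_chiFluctA measurable_chiFluct norm_le_of_chiFluctA_eq_one norm_le_of_chiFluctφ_eq_one)
open B1Ineq358TreeDecaySum (diam poly357 polyConst polyConst_nonneg sum_abs_term_le abs_poly357_le)
open B1Prop32InteractionBound (Leg legVal card_leg)
open B1Eq324SmallFieldLeaf (bondVar siteVar measurable_fieldOfCrd_apply measurable_norm_fieldOfCrd)
open B1Eq324FluctuationSubgaussian (hasSubgaussianMGF_apply_fluctMeasure hasSubgaussianMGF_fieldOfCrd_apply hasSubgaussianMGF_fst_prod
  hasSubgaussianMGF_snd_prod one_sub_integral_prod_mul_le)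
open B1Eq356FluctuationIntegral (integral356C integral356C_zero)

noncomputable section

/-! ## §0 Two generic facts on Mathlib's `HasSubgaussianMGF` -/

section Generic

variable {Ω : Type*} [MeasurableSpace Ω] {μ : Measure Ω} {X : Ω → ℝ} {c c' : ℝ≥0}

/-- Monotonicity of the sub-Gaussian parameter: `HasSubgaussianMGF X c μ` and `c ≤ c'` give `HasSubgaussianMGF X c' μ` (one parameter for a
finite family of variables = the largest one). [cite: Balaban1982Higgs1, (3.24) p.616] -/
theorem hasSubgaussianMGF_mono (h : HasSubgaussianMGF X c μ) (hc : c ≤ c') : HasSubgaussianMGF X c' μ := by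
  refine ⟨h.integrable_exp_mul, fun t => (h.mgf_le t).trans (Real.exp_le_exp.2 ?_)⟩
  have hc' : (c : ℝ) ≤ c' := NNReal.coe_le_coe.2 hc
  nlinarith [sq_nonneg t]

/-- Scaling with a dominated parameter: `HasSubgaussianMGF X c μ` and `r²c ≤ c'` give `HasSubgaussianMGF (r·X) c' μ` (Mathlib's
`HasSubgaussianMGF.const_mul` + `hasSubgaussianMGF_mono`) — the unit-lattice rescaling `(L^kε)^{(d−2)/2}` of (1.22). [cite: Balaban1982Higgs1, (1.22) p.607] -/
theorem hasSubgaussianMGF_const_mul_le (h : HasSubgaussianMGF X c μ) (r : ℝ) (hc : ⟨r ^ 2, sq_nonneg r⟩ * c ≤ c') :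
    HasSubgaussianMGF (fun ω => r * X ω) c' μ :=
  hasSubgaussianMGF_mono (h.const_mul r) hc

end Generic

/-! ## §1 The product law of (3.56) and (3.56) as one integral against it -/

section Law

variable {P : HiggsLattice.Params} {N : ℕ}

/-- The coordinates of the scalar fluctuation field `φ′` on the whole lattice `T^{(k)}` (II (2.28): `In (inSet N T^{(k)}) → ℝ`; the field is
`fieldOfCrd T^{(k)} x`) — the carrier of the inner measure of (3.56). [cite: Balaban1982Higgs1, (3.56) p.622] -/
abbrev Crd (P : HiggsLattice.Params) (N k : ℕ) : Type :=
  In (inSet (P := P) N (Finset.univ : Finset (HiggsLattice.Site P k))) → ℝ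

variable (C : ChargeData N) (Ω : Finset (HiggsLattice.Site P 0)) (B : HiggsLattice.VecField P 0) (μ0sq msq a : ℝ) (k : ℕ)

/-- **THE PRODUCT LAW `dμ_{C^{(k)}}(A′) dμ_{C^{(k)}(B^{(k+1)})}(φ′)` of (3.56)** on the product space `(A′, x)`: the typer's Gaussian
probability measure of the vector fluctuation field times the Gaussian probability measure with covariance `C^{(k)}(Ω, B)` of the scalar one in
coordinates (`Measure.prod`; r14's `integral356C` is the iterated integral against the two factors). [cite: Balaban1982Higgs1, (3.56) p.622] -/
def law356 : Measure (HiggsLattice.VecField P k × Crd P N k) :=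
  (fluctMeasure P μ0sq a k).prod (condGauss C Ω B msq a k (Finset.univ : Finset (HiggsLattice.Site P k)))

/-- Unfolding. [cite: Balaban1982Higgs1, (3.56) p.622] -/
theorem law356_eq : law356 C Ω B μ0sq msq a k
    = (fluctMeasure P μ0sq a k).prod (condGauss C Ω B msq a k (Finset.univ : Finset (HiggsLattice.Site P k))) := rfl

/-- **The product law is a probability measure** (`μ₀², m² > 0`, `a > 0`, `L > 1`, `k ≤ K`). [cite: Balaban1982Higgs1, (3.56) p.622] -/
theorem isProbabilityMeasure_law356 {μ0sq msq a : ℝ} (hμ : 0 < μ0sq) (hmsq : 0 < msq) (ha : 0 < a) (hL : 1 < (P.L : ℝ))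
    {k : ℕ} (hk : k ≤ P.K) : IsProbabilityMeasure (law356 C Ω B μ0sq msq a k) := by
  haveI := fluctMeasure_isProbability (P := P) hμ ha hL hk
  haveI := isProbabilityMeasure_condGauss C Ω B hmsq ha hL hk (Finset.univ : Finset (HiggsLattice.Site P k))
  unfold law356
  infer_instance

/-- The integrand of (3.56) on the product space. [cite: Balaban1982Higgs1, (3.56) p.622] -/
def integrand356 (t : ℝ) (V : HiggsLattice.VecField P k → HiggsLattice.ScalarField P k N → ℝ)
    (ω : HiggsLattice.VecField P k × Crd P N k) : ℝ :=
  chiFluctA t ω.1 * chiFluctφ t (fieldOfCrd (Finset.univ : Finset (HiggsLattice.Site P k)) ω.2)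
    * Real.exp (V ω.1 (fieldOfCrd Finset.univ ω.2))

/-- `x ↦ χ(φ′)(fieldOfCrd T^{(k)} x)` is measurable in the coordinates. [cite: Balaban1982Higgs1, (3.50) p.621] -/
theorem measurable_chiFluctφ_fieldOfCrd (t : ℝ) :
    Measurable fun x : Crd P N k => chiFluctφ t (fieldOfCrd (Finset.univ : Finset (HiggsLattice.Site P k)) x) := by
  unfold chiFluctφ
  exact measurable_chiFluct t (measurable_norm_fieldOfCrd (P := P) (N := N) Finset.univ)

/-- The integrand of (3.56) is measurable on the product as soon as `(A′, x) ↦ V(A′, φ′(x))` is. [cite: Balaban1982Higgs1, (3.56) p.622] -/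
theorem measurable_integrand356 (t : ℝ) {V : HiggsLattice.VecField P k → HiggsLattice.ScalarField P k N → ℝ}
    (hV : Measurable fun ω : HiggsLattice.VecField P k × Crd P N k => V ω.1 (fieldOfCrd Finset.univ ω.2)) :
    Measurable (integrand356 (P := P) (N := N) k t V) := by
  unfold integrand356
  exact (((measurable_chiFluctA t).comp measurable_fst).mul
    ((measurable_chiFluctφ_fieldOfCrd (P := P) (N := N) k t).comp measurable_snd)).mul (Real.measurable_exp.comp hV)

/-- `χ(A′)χ(φ′) ≠ 0` forces both cut-offs to equal `1` (each is a product of `{0,1}`-indicators). [cite: Balaban1982Higgs1, (3.43) p.619; (3.50) p.621] -/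
theorem chi_eq_one_of_mul_ne_zero {t : ℝ} {A' : HiggsLattice.VecField P k} {φ' : HiggsLattice.ScalarField P k N}
    (h : chiFluctA t A' * chiFluctφ t φ' ≠ 0) : chiFluctA t A' = 1 ∧ chiFluctφ t φ' = 1 := by
  have hA := left_ne_zero_of_mul h
  have hφ := right_ne_zero_of_mul h
  constructor
  · unfold chiFluctA at hA ⊢
    rw [chiFluct_eq_ite] at hA ⊢
    split_ifs at hA ⊢ with h1
    · rfl
    · exact absurd rfl hA
  · unfold chiFluctφ at hφ ⊢
    rw [chiFluct_eq_ite] at hφ ⊢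
    split_ifs at hφ ⊢ with h1
    · rfl
    · exact absurd rfl hφ

/-- The integrand of (3.56) is bounded by `e^{B}` when `|V| ≤ B` on `{χ(A′)χ(φ′) ≠ 0}` (off that set it vanishes).
[cite: Balaban1982Higgs1, (3.56) p.622] -/
theorem abs_integrand356_le (t : ℝ) {V : HiggsLattice.VecField P k → HiggsLattice.ScalarField P k N → ℝ} {Bd : ℝ}
    (hVB : ∀ A' φ', chiFluctA t A' * chiFluctφ t φ' ≠ 0 → |V A' φ'| ≤ Bd) (ω : HiggsLattice.VecField P k × Crd P N k) :
    |integrand356 (P := P) (N := N) k t V ω| ≤ Real.exp Bd := by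
  unfold integrand356
  by_cases h0 : chiFluctA t ω.1 * chiFluctφ t (fieldOfCrd (Finset.univ : Finset (HiggsLattice.Site P k)) ω.2) = 0
  · rw [h0, zero_mul, abs_zero]; exact (Real.exp_pos _).le
  · have hχ : 0 ≤ chiFluctA t ω.1 * chiFluctφ t (fieldOfCrd (Finset.univ : Finset (HiggsLattice.Site P k)) ω.2) :=
      mul_nonneg (chiFluctA_nonneg t _) (chiFluctφ_nonneg t _)
    have hχ1 : chiFluctA t ω.1 * chiFluctφ t (fieldOfCrd (Finset.univ : Finset (HiggsLattice.Site P k)) ω.2) ≤ 1 :=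
      mul_le_one₀ (chiFluctA_le_one t _) (chiFluctφ_nonneg t _) (chiFluctφ_le_one t _)
    rw [abs_mul, abs_of_nonneg hχ, Real.abs_exp]
    calc chiFluctA t ω.1 * chiFluctφ t (fieldOfCrd (Finset.univ : Finset (HiggsLattice.Site P k)) ω.2)
          * Real.exp (V ω.1 (fieldOfCrd Finset.univ ω.2))
        ≤ 1 * Real.exp Bd := by
          refine mul_le_mul hχ1 (Real.exp_le_exp.2 ((le_abs_self _).trans (hVB _ _ h0))) (Real.exp_pos _).le zero_le_one
      _ = Real.exp Bd := one_mul _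

/-- The integrand of (3.56) is integrable against the product law when `V` is measurable on the product and bounded on the support of the
cut-offs (`μ₀², m² > 0`, `a > 0`, `L > 1`, `k ≤ K`). [cite: Balaban1982Higgs1, (3.56) p.622] -/
theorem integrable_integrand356 {μ0sq msq a : ℝ} (hμ : 0 < μ0sq) (hmsq : 0 < msq) (ha : 0 < a) (hL : 1 < (P.L : ℝ))
    {k : ℕ} (hk : k ≤ P.K) (t : ℝ) {V : HiggsLattice.VecField P k → HiggsLattice.ScalarField P k N → ℝ}
    (hV : Measurable fun ω : HiggsLattice.VecField P k × Crd P N k => V ω.1 (fieldOfCrd Finset.univ ω.2)) {Bd : ℝ}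
    (hVB : ∀ A' φ', chiFluctA t A' * chiFluctφ t φ' ≠ 0 → |V A' φ'| ≤ Bd) :
    Integrable (integrand356 (P := P) (N := N) k t V) (law356 C Ω B μ0sq msq a k) := by
  haveI := isProbabilityMeasure_law356 C Ω B hμ hmsq ha hL hk
  refine (integrable_const (Real.exp Bd)).mono' (measurable_integrand356 (P := P) (N := N) k t hV).aestronglyMeasurable ?_
  exact ae_of_all _ fun ω => by rw [Real.norm_eq_abs]; exact abs_integrand356_le (P := P) (N := N) k t hVB ω

/-- **(3.56) IS ONE INTEGRAL AGAINST THE PRODUCT LAW**: for `V` measurable on the product and bounded on `{χ(A′)χ(φ′) ≠ 0}`, r14's iterated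
integral `integral356C` equals `∫ χ(A′)χ(φ′)e^{V} d(dμ_{C^{(k)}} ⊗ dμ_{C^{(k)}(B^{(k+1)})})` (Fubini, `MeasureTheory.integral_prod`; `μ₀², m² > 0`,
`a > 0`, `L > 1`, `k ≤ K`). [cite: Balaban1982Higgs1, (3.56) p.622] -/
theorem integral356C_eq_integral_law356 {μ0sq msq a : ℝ} (hμ : 0 < μ0sq) (hmsq : 0 < msq) (ha : 0 < a) (hL : 1 < (P.L : ℝ))
    {k : ℕ} (hk : k ≤ P.K) (t : ℝ) {V : HiggsLattice.VecField P k → HiggsLattice.ScalarField P k N → ℝ}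
    (hV : Measurable fun ω : HiggsLattice.VecField P k × Crd P N k => V ω.1 (fieldOfCrd Finset.univ ω.2)) {Bd : ℝ}
    (hVB : ∀ A' φ', chiFluctA t A' * chiFluctφ t φ' ≠ 0 → |V A' φ'| ≤ Bd) :
    integral356C C Ω B μ0sq msq a k t V = ∫ ω, integrand356 (P := P) (N := N) k t V ω ∂(law356 C Ω B μ0sq msq a k) := by
  haveI := fluctMeasure_isProbability (P := P) hμ ha hL hk
  haveI := isProbabilityMeasure_condGauss C Ω B hmsq ha hL hk (Finset.univ : Finset (HiggsLattice.Site P k))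
  rw [law356, integral_prod _ (integrable_integrand356 C Ω B hμ hmsq ha hL hk t hV hVB)]
  rfl

end Law

/-! ## §2 (3.57) on the carrier and its slot normal form -/

section Poly

variable {P : HiggsLattice.Params} {N : ℕ} (k qmax : ℕ)
  (coef : (q : ℕ) → (Fin q → HiggsLattice.Site P k) → (Fin q → Leg N P.d) → ℝ)

/-- **`V^{(k)}(A′, φ′)` of (3.57)** as the function of the two fluctuation fields that (3.56) integrates: p14's polynomial `poly357` (the display
re-indexed by the total degree `q = n + m ≤ qmax = n(n̄)`, kernels `coef q z κ = v^{(k)}_{j;μ}(B^{(k+1)}, ψ; x, y)` with `B^{(k+1)}, ψ` held fixed)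
at the legs `legVal k A′ φ′` = the unit-lattice components `(L^kε)^{(d−2)/2}φ′_j(x)`, `(L^kε)^{(d−2)/2}A′_μ(y)` of (1.22).
[cite: Balaban1982Higgs1, Prop. 3.2 (3.57) p.622] -/
def V357 : HiggsLattice.VecField P k → HiggsLattice.ScalarField P k N → ℝ :=
  fun A' φ' => poly357 qmax coef (legVal k A' φ')

/-- Unfolding. [cite: Balaban1982Higgs1, Prop. 3.2 (3.57) p.622] -/
theorem V357_apply (A' : HiggsLattice.VecField P k) (φ' : HiggsLattice.ScalarField P k N) :
    V357 k qmax coef A' φ' = poly357 qmax coef (legVal k A' φ') := rfl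

/-- **`V^{(k)}` AS A RANDOM VARIABLE on the product space of (3.56)** (the scalar field read off its coordinates).
[cite: Balaban1982Higgs1, Prop. 3.2 (3.57) p.622; (3.56) p.622] -/
def rv357 : HiggsLattice.VecField P k × Crd P N k → ℝ :=
  fun ω => V357 k qmax coef ω.1 (fieldOfCrd Finset.univ ω.2)

/-- Unfolding. [cite: Balaban1982Higgs1, Prop. 3.2 (3.57) p.622] -/
theorem rv357_apply (ω : HiggsLattice.VecField P k × Crd P N k) :
    rv357 k qmax coef ω = poly357 qmax coef (legVal k ω.1 (fieldOfCrd Finset.univ ω.2)) := rfl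

/-- THE MONOMIAL INDEX of (3.57): total degree `q ≤ qmax`, argument points `z : Fin q → T^{(k)}` (`x₁,…,x_n,y₁,…,y_m`), leg labels
`κ : Fin q → {1..N} ⊔ {1..d}` (`j₁,…,j_n;μ₁,…,μ_m`) — a finite type. [cite: Balaban1982Higgs1, Prop. 3.2 (3.57) p.622] -/
abbrev Idx (P : HiggsLattice.Params) (N k qmax : ℕ) : Type :=
  Σ q : Fin (qmax + 1), (Fin q → HiggsLattice.Site P k) × (Fin q → Leg N P.d)

/-- The coefficient `a_i` of the monomial `i = (q, z, κ)`: the kernel `v^{(k)}(q; z; κ)`. [cite: Balaban1982Higgs1, Prop. 3.2 (3.57) p.622] -/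
def coefOf (i : Idx P N k qmax) : ℝ := coef i.1 i.2.1 i.2.2

/-- The leg slots `J_i = {0, …, q−1}` of the monomial `i = (q, z, κ)`. [cite: Balaban1982Higgs1, Prop. 3.2 (3.57) p.622] -/
def slots (i : Idx P N k qmax) : Finset ℕ := Finset.range i.1

/-- THE LEG VARIABLES `X_{i s}`: the `s`-th leg of the monomial `i = (q, z, κ)` — the unit-lattice component `legVal k A′ φ′ (κ_s) (z_s)`
— as a function on the product space (junk `0` for `s ≥ q`). [cite: Balaban1982Higgs1, Prop. 3.2 (3.57) p.622] -/
def legRV (i : Idx P N k qmax) (s : ℕ) (ω : HiggsLattice.VecField P k × Crd P N k) : ℝ :=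
  if h : s < (i.1 : ℕ) then legVal k ω.1 (fieldOfCrd Finset.univ ω.2) (i.2.2 ⟨s, h⟩) (i.2.1 ⟨s, h⟩) else 0

/-- `|J_i| = q ≤ qmax` (hypothesis `hq` of r14's moment bounds). [cite: Balaban1982Higgs1, Prop. 3.2 (3.57) p.622] -/
theorem card_slots_le (i : Idx P N k qmax) : (slots (P := P) (N := N) k qmax i).card ≤ qmax := by
  unfold slots
  rw [Finset.card_range]
  exact Nat.lt_succ_iff.1 i.1.isLt

/-- On a slot `s < q` the leg variable is the displayed unit-lattice component. [cite: Balaban1982Higgs1, Prop. 3.2 (3.57) p.622] -/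
theorem legRV_of_lt (i : Idx P N k qmax) {s : ℕ} (hs : s < (i.1 : ℕ)) (ω : HiggsLattice.VecField P k × Crd P N k) :
    legRV k qmax i s ω = legVal k ω.1 (fieldOfCrd Finset.univ ω.2) (i.2.2 ⟨s, hs⟩) (i.2.1 ⟨s, hs⟩) := by
  unfold legRV
  rw [dif_pos hs]

/-- The monomial of index `i = (q, z, κ)`: `Π_{s ∈ slots i} legRV i s ω = Π_{l < q} legVal (κ_l) (z_l)`. [cite: Balaban1982Higgs1, Prop. 3.2 (3.57) p.622] -/
theorem prod_slots_legRV (i : Idx P N k qmax) (ω : HiggsLattice.VecField P k × Crd P N k) :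
    ∏ s ∈ slots k qmax i, legRV k qmax i s ω = ∏ l : Fin i.1, legVal k ω.1 (fieldOfCrd Finset.univ ω.2) (i.2.2 l) (i.2.1 l) := by
  unfold slots
  rw [Finset.prod_range]
  refine Finset.prod_congr rfl fun l _ => ?_
  rw [legRV_of_lt k qmax i l.isLt]

/-- **THE SLOT NORMAL FORM OF (3.57)**: `V^{(k)}(ω) = Σ_{i ∈ Idx} a_i · Π_{s ∈ J_i} X_{i s}(ω)` — literally the body of r14's
`B1Eq324GaussianMomentLeaf.poly Finset.univ slots coefOf legRV ω`. [cite: Balaban1982Higgs1, Prop. 3.2 (3.57) p.622] -/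
theorem rv357_eq_sum_prod (ω : HiggsLattice.VecField P k × Crd P N k) :
    rv357 k qmax coef ω = ∑ i : Idx P N k qmax, coefOf k qmax coef i * ∏ s ∈ slots k qmax i, legRV k qmax i s ω := by
  rw [rv357_apply, poly357, Finset.sum_range, Fintype.sum_sigma]
  refine Finset.sum_congr rfl fun q _ => ?_
  rw [Fintype.sum_prod_type]
  refine Finset.sum_congr rfl fun z _ => Finset.sum_congr rfl fun κ _ => ?_
  rw [prod_slots_legRV]
  rfl

end Poly

/-! ## §3 Every leg variable is sub-Gaussian under the product law, with one parameter -/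

section SubGaussian

variable {P : HiggsLattice.Params} {N : ℕ}
  (C : ChargeData N) (Ω : Finset (HiggsLattice.Site P 0)) (B : HiggsLattice.VecField P 0)

/-- Unfolding of p14's `legVal` at a scalar label: `(L^kε)^{(d−2)/2}·φ′(y)_j`. [cite: Balaban1982Higgs1, (1.22) p.607] -/
theorem legVal_inl (k : ℕ) (A' : HiggsLattice.VecField P k) (φ' : HiggsLattice.ScalarField P k N) (j : Fin N) (y : HiggsLattice.Site P k) :
    legVal k A' φ' (Sum.inl j) y = P.mesh k ^ (((P.d : ℝ) - 2) / 2) * φ' y j := rfl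

/-- Unfolding of p14's `legVal` at a vector label: `(L^kε)^{(d−2)/2}·A′_{⟨y, μ⟩}`. [cite: Balaban1982Higgs1, (1.22) p.607] -/
theorem legVal_inr (k : ℕ) (A' : HiggsLattice.VecField P k) (φ' : HiggsLattice.ScalarField P k N) (μ : Fin P.d) (y : HiggsLattice.Site P k) :
    legVal k A' φ' (Sum.inr μ) y = P.mesh k ^ (((P.d : ℝ) - 2) / 2) * A' ⟨y, μ⟩ := rfl

/-- THE ONE SUB-GAUSSIAN PARAMETER of the leg variables: `(L^kε)^{d−2}·σ²⁺` for a common bound `σ²` of the covariance diagonals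
`bondVar b`, `siteVar y i` (Prop. 2.3 (2.33) supplies such bounds). [cite: Balaban1982Higgs1, (2.33) p.611; (1.22) p.607] -/
def legParam (P : HiggsLattice.Params) (k : ℕ) (σsq : ℝ) : ℝ≥0 :=
  ⟨(P.mesh k ^ (((P.d : ℝ) - 2) / 2)) ^ 2, sq_nonneg _⟩ * σsq.toNNReal

/-- **EVERY LEG VARIABLE IS SUB-GAUSSIAN UNDER THE PRODUCT LAW, ONE PARAMETER**: for every label `l ∈ {1..N} ⊔ {1..d}` and every site
`y`, `ω ↦ legVal k ω.1 (φ′(ω.2)) l y` (i.e. `(L^kε)^{(d−2)/2}φ′_j(y)` or `(L^kε)^{(d−2)/2}A′_μ(y)`) has Mathlib's `HasSubgaussianMGF` with parameter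
`legParam P k σ²` under `law356`, whenever `σ²` bounds all `bondVar b` and all `siteVar y i` (`μ₀², m² > 0`, `a > 0`, `L > 1`, `k ≤ K`; r14's
`hasSubgaussianMGF_apply_fluctMeasure_of_le` / `hasSubgaussianMGF_fieldOfCrd_apply_of_le`, transported to the product by
`hasSubgaussianMGF_fst_prod` / `_snd_prod`, rescaled by `const_mul`) — p. 617 *"independent Gaussian random variables with the covariances
C^{(j),L^jε}"*. [cite: Balaban1982Higgs1, (3.24) p.616; p.617] -/
theorem hasSubgaussianMGF_legVal_law356 {μ0sq msq a : ℝ} (hμ : 0 < μ0sq) (hmsq : 0 < msq) (ha : 0 < a) (hL : 1 < (P.L : ℝ))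
    {k : ℕ} (hk : k ≤ P.K) {σsq : ℝ} (hσA : ∀ b : HiggsLattice.PBond P k, bondVar P μ0sq a k b ≤ σsq)
    (hσφ : ∀ (y : HiggsLattice.Site P k) (i : Fin N), siteVar P C Ω B msq a k Finset.univ y i ≤ σsq)
    (l : Leg N P.d) (y : HiggsLattice.Site P k) :
    HasSubgaussianMGF (fun ω : HiggsLattice.VecField P k × Crd P N k => legVal k ω.1 (fieldOfCrd Finset.univ ω.2) l y)
      (legParam P k σsq) (law356 C Ω B μ0sq msq a k) := by
  haveI := fluctMeasure_isProbability (P := P) hμ ha hL hk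
  haveI := isProbabilityMeasure_condGauss C Ω B hmsq ha hL hk (Finset.univ : Finset (HiggsLattice.Site P k))
  rcases l with j | ν
  · -- scalar leg `(L^kε)^{(d−2)/2} φ′(y)_j`, a variable of the SECOND factor
    have h1 : HasSubgaussianMGF (fun x : Crd P N k => fieldOfCrd (Finset.univ : Finset (HiggsLattice.Site P k)) x y j)
        σsq.toNNReal (condGauss C Ω B msq a k Finset.univ) :=
      B1Eq324FluctuationSubgaussian.hasSubgaussianMGF_fieldOfCrd_apply_of_le C Ω B hmsq ha hL hk Finset.univ y j (hσφ y j)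
    have h2 := hasSubgaussianMGF_snd_prod (μ₁ := fluctMeasure P μ0sq a k) h1
    have h3 := hasSubgaussianMGF_const_mul_le h2 (P.mesh k ^ (((P.d : ℝ) - 2) / 2)) (c' := legParam P k σsq) le_rfl
    simpa only [law356, legVal_inl] using h3
  · -- vector leg `(L^kε)^{(d−2)/2} A′_{⟨y,ν⟩}`, a variable of the FIRST factor
    have h1 : HasSubgaussianMGF (fun A : HiggsLattice.VecField P k => A ⟨y, ν⟩) σsq.toNNReal (fluctMeasure P μ0sq a k) :=
      B1Eq324FluctuationSubgaussian.hasSubgaussianMGF_apply_fluctMeasure_of_le (P := P) hμ ha hL hk ⟨y, ν⟩ (hσA ⟨y, ν⟩)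
    have h2 := hasSubgaussianMGF_fst_prod (μ₂ := condGauss C Ω B msq a k (Finset.univ : Finset (HiggsLattice.Site P k))) h1
    have h3 := hasSubgaussianMGF_const_mul_le h2 (P.mesh k ^ (((P.d : ℝ) - 2) / 2)) (c' := legParam P k σsq) le_rfl
    simpa only [law356, legVal_inr] using h3

/-- **… HENCE EVERY SLOT VARIABLE `X_{i s}`, `s ∈ J_i`, IS SUB-GAUSSIAN with the one parameter `legParam P k σ²`** under `law356` — the
hypothesis `h : ∀ i ∈ I, ∀ j ∈ J i, HasSubgaussianMGF (X i j) c μ` of r14's `B1Eq324GaussianMomentLeaf.integral_abs_poly_pow_le` /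
`abs_sum_cumulantOf_sub_truncExp_le_poly` for the displayed `V^{(k)}` (`I = Finset.univ`, `J = slots`, `X = legRV`, `c = legParam`, `μ = law356`).
[cite: Balaban1982Higgs1, (3.24) p.616; Prop. 3.2 (3.57) p.622] -/
theorem hasSubgaussianMGF_legRV {μ0sq msq a : ℝ} (hμ : 0 < μ0sq) (hmsq : 0 < msq) (ha : 0 < a) (hL : 1 < (P.L : ℝ))
    {k : ℕ} (hk : k ≤ P.K) {σsq : ℝ} (hσA : ∀ b : HiggsLattice.PBond P k, bondVar P μ0sq a k b ≤ σsq)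
    (hσφ : ∀ (y : HiggsLattice.Site P k) (i : Fin N), siteVar P C Ω B msq a k Finset.univ y i ≤ σsq) (qmax : ℕ) :
    ∀ i ∈ (Finset.univ : Finset (Idx P N k qmax)), ∀ s ∈ slots k qmax i,
      HasSubgaussianMGF (legRV k qmax i s) (legParam P k σsq) (law356 C Ω B μ0sq msq a k) := by
  intro i _ s hs
  have hs' : s < (i.1 : ℕ) := by unfold slots at hs; exact Finset.mem_range.1 hs
  have h := hasSubgaussianMGF_legVal_law356 C Ω B hμ hmsq ha hL hk hσA hσφ (i.2.2 ⟨s, hs'⟩) (i.2.1 ⟨s, hs'⟩)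
  refine h.congr (ae_of_all _ fun ω => ?_)
  exact (legRV_of_lt k qmax i hs' ω).symm

end SubGaussian

/-! ## §3′ The one parameter FROM PROPOSITION 2.3: with the (2.33) lower half it is `γ₀⁻¹`, uniformly in `k` and `ε` -/

section FromProp23

variable {P : HiggsLattice.Params} {N : ℕ}
  (C : ChargeData N) (Ω : Finset (HiggsLattice.Site P 0)) (B : HiggsLattice.VecField P 0)

open HiggsLattice (siteInner)
open HiggsFluctMeasure (precOp)
open B1Eq230FluctCov (precOpA)
open B1Eq324SmallFieldLeaf (bondVar_le_of_ineq233_lower' siteVar_le_of_ineq233_lower')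

/-- **THE UNIT-LATTICE RESCALING CANCELS THE (2.33) VARIANCE BOUND**: at `σ² = γ₀⁻¹(L^kε)^{−(d−2)}` (the bound on every `bondVar b`,
`siteVar y i` supplied by the lower half `γ₀(L^kε)^{−2}I ≤ a(L^{k+1}ε)^{−2}P + Δ^{(k)}` of Prop. 2.3 (2.33): `B1Eq324SmallFieldLeaf.bondVar_le_of_ineq233_lower'`
/ `siteVar_le_of_ineq233_lower'`) the parameter of the unit-lattice legs is `legParam P k σ² = γ₀⁻¹` — INDEPENDENT of `k` and of `ε`.
[cite: Balaban1982Higgs1, (2.33) p.611; (1.22) p.607] -/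
theorem legParam_ineq233 (k : ℕ) {γ₀ : ℝ} (hγ : 0 < γ₀) :
    legParam P k (γ₀⁻¹ * P.mesh k ^ (-((P.d : ℝ) - 2))) = (γ₀⁻¹).toNNReal := by
  have hs : 0 < P.mesh k := P.mesh_pos k
  have hσ : 0 ≤ γ₀⁻¹ * P.mesh k ^ (-((P.d : ℝ) - 2)) := mul_nonneg (inv_nonneg.2 hγ.le) (Real.rpow_nonneg hs.le _)
  apply NNReal.coe_injective
  simp only [legParam, NNReal.coe_mul, Real.coe_toNNReal _ hσ, Real.coe_toNNReal _ (inv_nonneg.2 hγ.le)]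
  have h1 : (P.mesh k ^ (((P.d : ℝ) - 2) / 2)) ^ 2 = P.mesh k ^ ((P.d : ℝ) - 2) := by
    rw [← Real.rpow_natCast, ← Real.rpow_mul hs.le]
    congr 1
    push_cast
    ring
  have h2 : P.mesh k ^ ((P.d : ℝ) - 2) * P.mesh k ^ (-((P.d : ℝ) - 2)) = 1 := by
    rw [← Real.rpow_add hs, add_neg_cancel, Real.rpow_zero]
  calc (P.mesh k ^ (((P.d : ℝ) - 2) / 2)) ^ 2 * (γ₀⁻¹ * P.mesh k ^ (-((P.d : ℝ) - 2)))
      = γ₀⁻¹ * (P.mesh k ^ ((P.d : ℝ) - 2) * P.mesh k ^ (-((P.d : ℝ) - 2))) := by rw [h1]; ring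
    _ = γ₀⁻¹ := by rw [h2, mul_one]

/-- **WITH PROPOSITION 2.3 (2.33) AS THE INPUT, EVERY UNIT-LATTICE LEG VARIABLE IS SUB-GAUSSIAN WITH THE PARAMETER `γ₀⁻¹`**, uniformly in
`k`, `ε`, the torus and the background: the (2.33) lower halves for the vector fluctuation operator (`precOp`, I (2.30) at `A = 0`, `N = d`) and for
the conditional scalar one (`precOpA`, (2.30)/(2.32) with background and region) give `bondVar`, `siteVar ≤ γ₀⁻¹(L^kε)^{−(d−2)}`, and the
rescaling `(L^kε)^{(d−2)/2}` of (1.22) turns this into `γ₀⁻¹` — p. 623 *"the properties formulated in the Propositions 2.2 and 2.3 … are sufficient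
for the assumptions made in the lemma [2]"*, made kernel-explicit for the sub-Gaussian input (`μ₀², m² > 0`, `a > 0`, `L > 1`, `k ≤ K`).
[cite: Balaban1982Higgs1, (2.33) p.611; p.623; (3.24) p.616] -/
theorem hasSubgaussianMGF_legVal_of_ineq233 {μ0sq msq a : ℝ} (hμ : 0 < μ0sq) (hmsq : 0 < msq) (ha : 0 < a) (hL : 1 < (P.L : ℝ))
    {k : ℕ} (hk : k ≤ P.K) {γ₀ : ℝ} (hγ : 0 < γ₀)
    (h233A : ∀ f : HiggsLattice.ScalarField P k P.d,
      γ₀ * (P.mesh k)⁻¹ ^ 2 * siteInner f f ≤ siteInner f (precOp P μ0sq a k f))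
    (h233φ : ∀ f : HiggsLattice.ScalarField P k N,
      γ₀ * (P.mesh k)⁻¹ ^ 2 * siteInner f f ≤ siteInner f (precOpA C Ω B msq a k f))
    (l : Leg N P.d) (y : HiggsLattice.Site P k) :
    HasSubgaussianMGF (fun ω : HiggsLattice.VecField P k × Crd P N k => legVal k ω.1 (fieldOfCrd Finset.univ ω.2) l y)
      (γ₀⁻¹).toNNReal (law356 C Ω B μ0sq msq a k) := by
  rw [← legParam_ineq233 (P := P) k hγ]
  exact hasSubgaussianMGF_legVal_law356 C Ω B hμ hmsq ha hL hk
    (fun b => bondVar_le_of_ineq233_lower' (P := P) hμ ha hL hk hγ h233A b)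
    (fun y i => siteVar_le_of_ineq233_lower' C Ω B hmsq ha hL hk Finset.univ hγ h233φ y i) l y

/-- … and every slot variable `X_{i s}`, `s ∈ J_i`, with the same `γ₀⁻¹` (the hypothesis `h` of r14's moment bounds, from Prop. 2.3).
[cite: Balaban1982Higgs1, (2.33) p.611; (3.24) p.616; Prop. 3.2 (3.57) p.622] -/
theorem hasSubgaussianMGF_legRV_of_ineq233 {μ0sq msq a : ℝ} (hμ : 0 < μ0sq) (hmsq : 0 < msq) (ha : 0 < a) (hL : 1 < (P.L : ℝ))
    {k : ℕ} (hk : k ≤ P.K) {γ₀ : ℝ} (hγ : 0 < γ₀)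
    (h233A : ∀ f : HiggsLattice.ScalarField P k P.d,
      γ₀ * (P.mesh k)⁻¹ ^ 2 * siteInner f f ≤ siteInner f (precOp P μ0sq a k f))
    (h233φ : ∀ f : HiggsLattice.ScalarField P k N,
      γ₀ * (P.mesh k)⁻¹ ^ 2 * siteInner f f ≤ siteInner f (precOpA C Ω B msq a k f)) (qmax : ℕ) :
    ∀ i ∈ (Finset.univ : Finset (Idx P N k qmax)), ∀ s ∈ slots k qmax i,
      HasSubgaussianMGF (legRV k qmax i s) (γ₀⁻¹).toNNReal (law356 C Ω B μ0sq msq a k) := by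
  rw [← legParam_ineq233 (P := P) k hγ]
  exact hasSubgaussianMGF_legRV C Ω B hμ hmsq ha hL hk
    (fun b => bondVar_le_of_ineq233_lower' (P := P) hμ ha hL hk hγ h233A b)
    (fun y i => siteVar_le_of_ineq233_lower' C Ω B hmsq ha hL hk Finset.univ hγ h233φ y i) qmax

end FromProp23

/-! ## §4 The coefficient sum under (3.58) -/

section Coefficients

variable {P : HiggsLattice.Params} {N : ℕ} (k qmax : ℕ)
  (coef : (q : ℕ) → (Fin q → HiggsLattice.Site P k) → (Fin q → Leg N P.d) → ℝ)

/-- **`Σ_i |a_i| ≤ A₀·|T^{(k)}|·polyConst qmax (N+d) 1 d δ₀` UNDER (3.58)** in p14's diameter currency `|v^{(k)}(q; z; κ)| ≤ A₀e^{−δ₀·diam z}`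
(`A₀ = O(1)(L^kε)^{κ₀}`; p. 616 *"The coefficients of the polynomial V are proportional to some positive powers of ε"*) — the tree-decay
summation of p. 625 with all legs set to `1` (p14's `sum_abs_term_le`); this is the `Σ|a_i|` entering r14's `polyMomentBound`.
[cite: Balaban1982Higgs1, Prop. 3.2 (3.58) p.622; p.616; p.625] -/
theorem sum_abs_coefOf_le {A₀ δ₀ : ℝ} (hA₀ : 0 ≤ A₀) (hδ₀ : 0 < δ₀)
    (h358 : ∀ q, q ≤ qmax → ∀ (z : Fin q → HiggsLattice.Site P k) (κ : Fin q → Leg N P.d),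
      |coef q z κ| ≤ A₀ * Real.exp (-(δ₀ * (diam z : ℝ)))) :
    ∑ i : Idx P N k qmax, |coefOf k qmax coef i|
      ≤ A₀ * (Fintype.card (HiggsLattice.Site P k) : ℝ) * polyConst qmax ((N : ℝ) + P.d) 1 P.d δ₀ := by
  rw [Fintype.sum_sigma]
  have hq : ∀ q : Fin (qmax + 1),
      ∑ zκ : (Fin q → HiggsLattice.Site P k) × (Fin q → Leg N P.d), |coefOf k qmax coef ⟨q, zκ⟩|
        ≤ A₀ * (Fintype.card (HiggsLattice.Site P k) : ℝ) * (((N : ℝ) + P.d) * 1) ^ (q : ℕ) * B1Ineq358TreeDecaySum.treeConst P.d δ₀ q := by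
    intro q
    have h := sum_abs_term_le (q : ℕ) coef (fun (_ : Leg N P.d) (_ : HiggsLattice.Site P k) => (1 : ℝ)) hA₀ hδ₀ zero_le_one
      (h358 q (Nat.lt_succ_iff.1 q.isLt)) (fun _ _ => by rw [abs_one])
    rw [Fintype.sum_prod_type]
    have hcard : (Fintype.card (Leg N P.d) : ℝ) = (N : ℝ) + P.d := by rw [card_leg]; push_cast; ring
    simp only [Finset.prod_const_one, mul_one] at h
    rw [hcard] at h
    simpa only [coefOf, mul_one] using h
  calc ∑ q : Fin (qmax + 1), ∑ zκ : (Fin q → HiggsLattice.Site P k) × (Fin q → Leg N P.d), |coefOf k qmax coef ⟨q, zκ⟩|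
      ≤ ∑ q : Fin (qmax + 1), A₀ * (Fintype.card (HiggsLattice.Site P k) : ℝ) * (((N : ℝ) + P.d) * 1) ^ (q : ℕ)
          * B1Ineq358TreeDecaySum.treeConst P.d δ₀ q := Finset.sum_le_sum fun q _ => hq q
    _ = A₀ * (Fintype.card (HiggsLattice.Site P k) : ℝ) * polyConst qmax ((N : ℝ) + P.d) 1 P.d δ₀ := by
        unfold polyConst
        rw [Finset.mul_sum, Finset.sum_range]
        refine Finset.sum_congr rfl fun q _ => ?_
        ring

end Coefficients

/-! ## §5 *"the restrictions on the fields"*: `|V^{(k)}| ≤ B` on the support of `χ(A′)χ(φ′)` -/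

section Restrictions

variable {P : HiggsLattice.Params} {N : ℕ} (k qmax : ℕ)
  (coef : (q : ℕ) → (Fin q → HiggsLattice.Site P k) → (Fin q → Leg N P.d) → ℝ)

/-- **ON `{χ(A′)χ(φ′) ≠ 0}` EVERY LEG IS BOUNDED**: `|legVal k A′ φ′ l y| ≤ (L^kε)^{(d−2)/2}·t` — (3.43) *"χ(A′) = Π_x χ({|A′(x)| ≦ p₁(L^kε)})"*
and (3.50) give `|A′_μ(y)| ≤ |A′(y)| ≤ t`, `|φ′_j(y)| ≤ |φ′(y)| ≤ t` (component ≤ Euclidean norm, `PiLp.norm_apply_le`).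
[cite: Balaban1982Higgs1, (3.43) p.619; (3.50) p.621; p.625] -/
theorem abs_legVal_le_of_chi_ne_zero {t : ℝ} {A' : HiggsLattice.VecField P k} {φ' : HiggsLattice.ScalarField P k N}
    (h : chiFluctA t A' * chiFluctφ t φ' ≠ 0) (l : Leg N P.d) (y : HiggsLattice.Site P k) :
    |legVal k A' φ' l y| ≤ P.mesh k ^ (((P.d : ℝ) - 2) / 2) * t := by
  obtain ⟨hA, hφ⟩ := chi_eq_one_of_mul_ne_zero (P := P) (N := N) k h
  have hs : 0 ≤ P.mesh k ^ (((P.d : ℝ) - 2) / 2) := Real.rpow_nonneg (P.mesh_pos k).le _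
  rcases l with j | ν
  · rw [legVal_inl, abs_mul, abs_of_nonneg hs]
    refine mul_le_mul_of_nonneg_left ?_ hs
    have h1 := PiLp.norm_apply_le (φ' y) j
    rw [Real.norm_eq_abs] at h1
    exact h1.trans (norm_le_of_chiFluctφ_eq_one hφ y)
  · rw [legVal_inr, abs_mul, abs_of_nonneg hs]
    refine mul_le_mul_of_nonneg_left ?_ hs
    have h1 := PiLp.norm_apply_le (toSite A' y) ν
    rw [Real.norm_eq_abs] at h1
    exact h1.trans (norm_le_of_chiFluctA_eq_one hA y)

/-- THE EXPLICIT BOUND `B` of `|V^{(k)}|` on the support of the cut-offs: `A₀·|T^{(k)}|·polyConst qmax (N+d) ((L^kε)^{(d−2)/2}t) d δ₀`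
(p14's p. 625 constant at the leg bound `(L^kε)^{(d−2)/2}t`). [cite: Balaban1982Higgs1, p.625; Prop. 3.2 (3.58) p.622] -/
def bound357 (P : HiggsLattice.Params) (N k qmax : ℕ) (A₀ δ₀ t : ℝ) : ℝ :=
  A₀ * (Fintype.card (HiggsLattice.Site P k) : ℝ) * polyConst qmax ((N : ℝ) + P.d) (P.mesh k ^ (((P.d : ℝ) - 2) / 2) * t) P.d δ₀

/-- `0 ≤ bound357` for `A₀ ≥ 0`, `δ₀ ≥ 0`, `t ≥ 0`. [cite: Balaban1982Higgs1, p.625] -/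
theorem bound357_nonneg {A₀ δ₀ t : ℝ} (hA₀ : 0 ≤ A₀) (hδ₀ : 0 ≤ δ₀) (ht : 0 ≤ t) : 0 ≤ bound357 P N k qmax A₀ δ₀ t := by
  unfold bound357
  refine mul_nonneg (mul_nonneg hA₀ (Nat.cast_nonneg _)) (polyConst_nonneg qmax ?_ P.d hδ₀)
  exact mul_nonneg (by positivity) (mul_nonneg (Real.rpow_nonneg (P.mesh_pos k).le _) ht)

/-- **`|V^{(k)}(A′, φ′)| ≤ bound357` ON `{χ(A′)χ(φ′) ≠ 0}`** under (3.58) in the diameter currency (`t ≥ 0`) — *"Using representation (3.57) in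
Proposition 3.2 and the restrictions on the fields A, φ we can estimate the absolute value of the interaction"* (p. 625; p14's `abs_poly357_le`):
the hypothesis `hVB` of p27's `B1Eq324CumulantTaylor.eq324_chi` / r14's `abs_sum_cumulantOf_sub_truncExp_le_poly` DISCHARGED for the displayed `V^{(k)}`.
[cite: Balaban1982Higgs1, p.625; Prop. 3.2 (3.57)–(3.58) p.622] -/
theorem abs_V357_le_of_chi_ne_zero {A₀ δ₀ t : ℝ} (hA₀ : 0 ≤ A₀) (hδ₀ : 0 < δ₀) (ht : 0 ≤ t)
    (h358 : ∀ q, q ≤ qmax → ∀ (z : Fin q → HiggsLattice.Site P k) (κ : Fin q → Leg N P.d),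
      |coef q z κ| ≤ A₀ * Real.exp (-(δ₀ * (diam z : ℝ))))
    {A' : HiggsLattice.VecField P k} {φ' : HiggsLattice.ScalarField P k N} (h : chiFluctA t A' * chiFluctφ t φ' ≠ 0) :
    |V357 k qmax coef A' φ'| ≤ bound357 P N k qmax A₀ δ₀ t := by
  have hq₀ : 0 ≤ P.mesh k ^ (((P.d : ℝ) - 2) / 2) * t := mul_nonneg (Real.rpow_nonneg (P.mesh_pos k).le _) ht
  have hb := abs_poly357_le qmax coef (legVal k A' φ') hA₀ hδ₀ hq₀ h358 (abs_legVal_le_of_chi_ne_zero (P := P) (N := N) k h)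
  rw [card_leg] at hb
  push_cast at hb
  exact hb

end Restrictions

/-! ## §6 The product cut-off `χ(A′)χ(φ′)` on the product space -/

section CutOff

variable {P : HiggsLattice.Params} {N : ℕ}
  (C : ChargeData N) (Ω : Finset (HiggsLattice.Site P 0)) (B : HiggsLattice.VecField P 0) (μ0sq msq a : ℝ) (k : ℕ)

/-- **The product cut-off `χ(A′)χ(φ′)` of (3.56)** as a function on the product space. [cite: Balaban1982Higgs1, (3.56) p.622] -/
def chi356 (k : ℕ) (t : ℝ) (ω : HiggsLattice.VecField P k × Crd P N k) : ℝ :=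
  chiFluctA t ω.1 * chiFluctφ t (fieldOfCrd (Finset.univ : Finset (HiggsLattice.Site P k)) ω.2)

/-- Unfolding. [cite: Balaban1982Higgs1, (3.56) p.622] -/
theorem chi356_apply (t : ℝ) (ω : HiggsLattice.VecField P k × Crd P N k) :
    chi356 (P := P) (N := N) k t ω = chiFluctA t ω.1 * chiFluctφ t (fieldOfCrd (Finset.univ : Finset (HiggsLattice.Site P k)) ω.2) := rfl

/-- `χ(A′)χ(φ′)` is measurable on the product. [cite: Balaban1982Higgs1, (3.56) p.622] -/
theorem measurable_chi356 (t : ℝ) : Measurable (chi356 (P := P) (N := N) k t) :=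
  ((measurable_chiFluctA t).comp measurable_fst).mul ((measurable_chiFluctφ_fieldOfCrd (P := P) (N := N) k t).comp measurable_snd)

/-- `0 ≤ χ(A′)χ(φ′)`. [cite: Balaban1982Higgs1, (3.56) p.622] -/
theorem chi356_nonneg (t : ℝ) (ω : HiggsLattice.VecField P k × Crd P N k) : 0 ≤ chi356 (P := P) (N := N) k t ω :=
  mul_nonneg (chiFluctA_nonneg t _) (chiFluctφ_nonneg t _)

/-- `χ(A′)χ(φ′) ≤ 1`. [cite: Balaban1982Higgs1, (3.56) p.622] -/
theorem chi356_le_one (t : ℝ) (ω : HiggsLattice.VecField P k × Crd P N k) : chi356 (P := P) (N := N) k t ω ≤ 1 :=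
  mul_le_one₀ (chiFluctA_le_one t _) (chiFluctφ_nonneg t _) (chiFluctφ_le_one t _)

/-- **`⟨χ(A′)χ(φ′)⟩_{law356} = ⟨χ(A′)⟩·⟨χ(φ′)⟩`** (`MeasureTheory.integral_prod_mul`) — the two small-field probabilities of leaf (a)
(r14's `B1Eq324SmallFieldLeaf`); `μ₀², m² > 0`, `a > 0`, `L > 1`, `k ≤ K`. [cite: Balaban1982Higgs1, (3.56) p.622; (3.24) p.616] -/
theorem integral_chi356 {μ0sq msq a : ℝ} (hμ : 0 < μ0sq) (hmsq : 0 < msq) (ha : 0 < a) (hL : 1 < (P.L : ℝ)) {k : ℕ} (hk : k ≤ P.K)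
    (t : ℝ) :
    ∫ ω, chi356 (P := P) (N := N) k t ω ∂(law356 C Ω B μ0sq msq a k)
      = (∫ A', chiFluctA t A' ∂(fluctMeasure P μ0sq a k))
        * ∫ x, chiFluctφ t (fieldOfCrd (Finset.univ : Finset (HiggsLattice.Site P k)) x)
            ∂(condGauss C Ω B msq a k (Finset.univ : Finset (HiggsLattice.Site P k))) := by
  haveI := fluctMeasure_isProbability (P := P) hμ ha hL hk
  haveI := isProbabilityMeasure_condGauss C Ω B hmsq ha hL hk (Finset.univ : Finset (HiggsLattice.Site P k))
  unfold law356 chi356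
  exact integral_prod_mul (μ := fluctMeasure P μ0sq a k) (ν := condGauss C Ω B msq a k Finset.univ) (chiFluctA t)
    (fun x : Crd P N k => chiFluctφ t (fieldOfCrd (Finset.univ : Finset (HiggsLattice.Site P k)) x))

/-- … which is r14's (3.56) at `V = 0` (`B1Eq356FluctuationIntegral.integral356C_zero`). [cite: Balaban1982Higgs1, (3.56) p.622] -/
theorem integral_chi356_eq_integral356C_zero {μ0sq msq a : ℝ} (hμ : 0 < μ0sq) (hmsq : 0 < msq) (ha : 0 < a) (hL : 1 < (P.L : ℝ))
    {k : ℕ} (hk : k ≤ P.K) (t : ℝ) :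
    ∫ ω, chi356 (P := P) (N := N) k t ω ∂(law356 C Ω B μ0sq msq a k) = integral356C C Ω B μ0sq msq a k t (fun _ _ => 0) := by
  rw [integral_chi356 C Ω B hμ hmsq ha hL hk t, integral356C_zero]

/-- **THE TAIL OF THE PRODUCT CUT-OFF: `1 − ⟨χ(A′)χ(φ′)⟩ ≤ (1 − ⟨χ(A′)⟩) + (1 − ⟨χ(φ′)⟩)`** (r14's `one_sub_integral_prod_mul_le`) — the
`√⟨1−χ⟩` input of leaf (b) for the product law from the two one-factor Gaussian tails of `B1Eq324SmallFieldLeaf`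
(`one_sub_integral_chiFluctA_le`, `one_sub_integral_chiFluctφ_le`). [cite: Balaban1982Higgs1, (3.56) p.622; (3.24) p.616] -/
theorem one_sub_integral_chi356_le {μ0sq msq a : ℝ} (hμ : 0 < μ0sq) (hmsq : 0 < msq) (ha : 0 < a) (hL : 1 < (P.L : ℝ))
    {k : ℕ} (hk : k ≤ P.K) (t : ℝ) :
    1 - ∫ ω, chi356 (P := P) (N := N) k t ω ∂(law356 C Ω B μ0sq msq a k)
      ≤ (1 - ∫ A', chiFluctA t A' ∂(fluctMeasure P μ0sq a k))
        + (1 - ∫ x, chiFluctφ t (fieldOfCrd (Finset.univ : Finset (HiggsLattice.Site P k)) x)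
            ∂(condGauss C Ω B msq a k (Finset.univ : Finset (HiggsLattice.Site P k)))) := by
  haveI := fluctMeasure_isProbability (P := P) hμ ha hL hk
  haveI := isProbabilityMeasure_condGauss C Ω B hmsq ha hL hk (Finset.univ : Finset (HiggsLattice.Site P k))
  unfold law356 chi356
  exact one_sub_integral_prod_mul_le (chiFluctA_nonneg t) (chiFluctA_le_one t) (fun x => chiFluctφ_nonneg t _)
    (fun x => chiFluctφ_le_one t _) (measurable_chiFluctA t).aestronglyMeasurable
    (measurable_chiFluctφ_fieldOfCrd (P := P) (N := N) k t).aestronglyMeasurable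

/-- `∫ (1 − χ) d law356 = 1 − ∫ χ d law356` (probability measure; the form `√(∫(1−χ))` of leaf (b)). [cite: Balaban1982Higgs1, (3.56) p.622] -/
theorem integral_one_sub_chi356 {μ0sq msq a : ℝ} (hμ : 0 < μ0sq) (hmsq : 0 < msq) (ha : 0 < a) (hL : 1 < (P.L : ℝ))
    {k : ℕ} (hk : k ≤ P.K) (t : ℝ) :
    ∫ ω, (1 - chi356 (P := P) (N := N) k t ω) ∂(law356 C Ω B μ0sq msq a k)
      = 1 - ∫ ω, chi356 (P := P) (N := N) k t ω ∂(law356 C Ω B μ0sq msq a k) := by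
  haveI := isProbabilityMeasure_law356 C Ω B hμ hmsq ha hL hk
  have hint : Integrable (chi356 (P := P) (N := N) k t) (law356 C Ω B μ0sq msq a k) :=
    (integrable_const (1 : ℝ)).mono' (measurable_chi356 (P := P) (N := N) k t).aestronglyMeasurable
      (ae_of_all _ fun ω => by rw [Real.norm_eq_abs, abs_of_nonneg (chi356_nonneg k t ω)]; exact chi356_le_one k t ω)
  rw [integral_sub (integrable_const 1) hint, integral_const, probReal_univ, one_smul]

/-- **`⟨χ(A′)χ(φ′)⟩ ≥ ½` AS SOON AS BOTH ONE-FACTOR TAILS ARE `≤ ¼`** — hypothesis `hZ` of leaf (b) for the product law (the tails are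
`≤ 2d|T^{(k)}|e^{−t²/(2dσ²)}`, `≤ 2N|T^{(k)}|e^{−t²/(2Nσ²)}` by `B1Eq324SmallFieldLeaf.one_sub_integral_chiFluctA_le` / `…φ_le`).
[cite: Balaban1982Higgs1, (3.56) p.622; (3.24) p.616] -/
theorem half_le_integral_chi356 {μ0sq msq a : ℝ} (hμ : 0 < μ0sq) (hmsq : 0 < msq) (ha : 0 < a) (hL : 1 < (P.L : ℝ))
    {k : ℕ} (hk : k ≤ P.K) (t : ℝ)
    (hτA : 1 - ∫ A', chiFluctA t A' ∂(fluctMeasure P μ0sq a k) ≤ 1 / 4)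
    (hτφ : 1 - ∫ x, chiFluctφ t (fieldOfCrd (Finset.univ : Finset (HiggsLattice.Site P k)) x)
        ∂(condGauss C Ω B msq a k (Finset.univ : Finset (HiggsLattice.Site P k))) ≤ 1 / 4) :
    1 / 2 ≤ ∫ ω, chi356 (P := P) (N := N) k t ω ∂(law356 C Ω B μ0sq msq a k) := by
  have h := one_sub_integral_chi356_le C Ω B hμ hmsq ha hL hk t
  linarith

end CutOff

/-! ## §7 (3.56) for the displayed `V^{(k)}` as one integral against the product law -/

section Displayed

variable {P : HiggsLattice.Params} {N : ℕ}
  (C : ChargeData N) (Ω : Finset (HiggsLattice.Site P 0)) (B : HiggsLattice.VecField P 0) (μ0sq msq a : ℝ) (k qmax : ℕ)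
  (coef : (q : ℕ) → (Fin q → HiggsLattice.Site P k) → (Fin q → Leg N P.d) → ℝ)

/-- Each leg variable `ω ↦ legVal k ω.1 (φ′(ω.2)) l y` is measurable on the product (linear in the coordinates).
[cite: Balaban1982Higgs1, Prop. 3.2 (3.57) p.622] -/
theorem measurable_legVal_prod (l : Leg N P.d) (y : HiggsLattice.Site P k) :
    Measurable fun ω : HiggsLattice.VecField P k × Crd P N k => legVal k ω.1 (fieldOfCrd Finset.univ ω.2) l y := by
  rcases l with j | ν
  · simp only [legVal_inl]
    exact ((measurable_fieldOfCrd_apply (P := P) (N := N) Finset.univ y j).comp measurable_snd).const_mul _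
  · simp only [legVal_inr]
    exact ((measurable_pi_apply (⟨y, ν⟩ : HiggsLattice.PBond P k)).comp measurable_fst).const_mul _

/-- **`V^{(k)}` is measurable on the product space** (a polynomial in measurable leg variables). [cite: Balaban1982Higgs1, Prop. 3.2 (3.57) p.622] -/
theorem measurable_rv357 : Measurable (rv357 (P := P) (N := N) k qmax coef) := by
  have h : rv357 (P := P) (N := N) k qmax coef
      = fun ω => ∑ i : Idx P N k qmax, coefOf k qmax coef i * ∏ s ∈ slots k qmax i, legRV k qmax i s ω :=
    funext (rv357_eq_sum_prod k qmax coef)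
  rw [h]
  refine Finset.measurable_sum _ fun i _ => (Finset.measurable_prod _ fun s hs => ?_).const_mul _
  have hs' : s < (i.1 : ℕ) := by unfold slots at hs; exact Finset.mem_range.1 hs
  have h2 : legRV k qmax i s
      = fun ω : HiggsLattice.VecField P k × Crd P N k => legVal k ω.1 (fieldOfCrd Finset.univ ω.2) (i.2.2 ⟨s, hs'⟩) (i.2.1 ⟨s, hs'⟩) :=
    funext fun ω => legRV_of_lt k qmax i hs' ω
  rw [h2]
  exact measurable_legVal_prod k (i.2.2 ⟨s, hs'⟩) (i.2.1 ⟨s, hs'⟩)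

/-- **(3.56) FOR THE DISPLAYED `V^{(k)}` IS `∫ χ(A′)χ(φ′)·e^{V^{(k)}} d law356`** — r14's `integral356C … (V357 k qmax coef)` as one integral of
`chi356 · exp ∘ rv357` against the product law (`μ₀², m² > 0`, `a > 0`, `L > 1`, `k ≤ K`, `t ≥ 0`, (3.58) in the diameter currency).
[cite: Balaban1982Higgs1, (3.56) p.622; Prop. 3.2 (3.57)–(3.58) p.622] -/
theorem integral356C_V357_eq {μ0sq msq a : ℝ} (hμ : 0 < μ0sq) (hmsq : 0 < msq) (ha : 0 < a) (hL : 1 < (P.L : ℝ))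
    {k : ℕ} (hk : k ≤ P.K) (qmax : ℕ) (coef : (q : ℕ) → (Fin q → HiggsLattice.Site P k) → (Fin q → Leg N P.d) → ℝ)
    {A₀ δ₀ t : ℝ} (hA₀ : 0 ≤ A₀) (hδ₀ : 0 < δ₀) (ht : 0 ≤ t)
    (h358 : ∀ q, q ≤ qmax → ∀ (z : Fin q → HiggsLattice.Site P k) (κ : Fin q → Leg N P.d),
      |coef q z κ| ≤ A₀ * Real.exp (-(δ₀ * (diam z : ℝ)))) :
    integral356C C Ω B μ0sq msq a k t (V357 k qmax coef)
      = ∫ ω, chi356 (P := P) (N := N) k t ω * Real.exp (rv357 k qmax coef ω) ∂(law356 C Ω B μ0sq msq a k) :=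
  integral356C_eq_integral_law356 C Ω B hμ hmsq ha hL hk t (measurable_rv357 (P := P) (N := N) k qmax coef)
    (fun _ _ h => abs_V357_le_of_chi_ne_zero k qmax coef hA₀ hδ₀ ht h358 h)

/-- **`|V^{(k)}(ω)| ≤ bound357` ON `{chi356 ≠ 0}`** — the random-variable form of §5 (hypothesis `hVB` of r14's
`abs_sum_cumulantOf_sub_truncExp_le_poly` with `χ = chi356 k t`, `B = bound357 …`). [cite: Balaban1982Higgs1, p.625; Prop. 3.2 (3.58) p.622] -/
theorem abs_rv357_le_of_chi356_ne_zero {A₀ δ₀ t : ℝ} (hA₀ : 0 ≤ A₀) (hδ₀ : 0 < δ₀) (ht : 0 ≤ t)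
    (h358 : ∀ q, q ≤ qmax → ∀ (z : Fin q → HiggsLattice.Site P k) (κ : Fin q → Leg N P.d),
      |coef q z κ| ≤ A₀ * Real.exp (-(δ₀ * (diam z : ℝ))))
    (ω : HiggsLattice.VecField P k × Crd P N k) (h : chi356 (P := P) (N := N) k t ω ≠ 0) :
    |rv357 k qmax coef ω| ≤ bound357 P N k qmax A₀ δ₀ t :=
  abs_V357_le_of_chi_ne_zero k qmax coef hA₀ hδ₀ ht h358 h

end Displayed

end

end Literature.MathematicalPhysics.QuantumFieldTheory.Balaban1983to89.B1Eq357FluctuationPolynomial
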